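import Literature.MathematicalPhysics.QuantumLattice.PairCorrelations
import Literature.MathematicalPhysics.QuantumLattice.PairCorrelationsB1gCharProofs
import Literature.MathematicalPhysics.QuantumLattice.FermionOperatorsProofs
import HarnessLib

/-!
# Local singlet pairs on an arbitrary step set; the `d_{xy}` (`B₂g`) channel

Companion of `Literature.MathematicalPhysics.QuantumLattice.PairCorrelations`, whose local
singlet pair `localPair g L x = Σ_{e ∈ {0} ∪ unitSteps} (g e/√2) (c_{x↑} c_{x+e,↓} - c_{x↓} c_{x+e,↑})`
hard-codes the step set `{0, ±e₁, ±e₂}` (on-site and nearest-neighbour bonds), so that pair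
fields living on other bonds — next-nearest-neighbour (diagonal) `d_{xy}`, extended `s'` on the
diagonals, `g`-wave, … — are not expressible with it.

## Contents

* `singletBond L x e = c_{x↑} c_{x+e,↓} - c_{x↓} c_{x+e,↑}` on the bond `(x, x + e)` of the
  fermionic torus `(ℤ/Lℤ)²` (neighbour via `Torus.proj`, orbitals via `FermionTorus.ofTorusSite`),
  its adjoint, and bond reversal `B_x(-e) = B_{x-e}(e)` (`singletBond_neg`, by the CAR);
* **`localPairOn S g L x = Σ_{e ∈ S} (g e/√2) (c_{x↑} c_{x+e,↓} - c_{x↓} c_{x+e,↑})`** for an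
  ARBITRARY finite step set `S : Finset (Site 2)` and **`pairFieldOn S g L = Σ_x localPairOn S g L x`**;
  the bridges `localPairOn (insert 0 unitSteps) g L x = localPair g L x`,
  `pairFieldOn (insert 0 unitSteps) g L = pairField g L` are `rfl`; additivity in `S`, linearity
  in `g` (`localPairOn_empty/insert/union/congr/subset/add/smul/neg`, `pairFieldOn_union/add/smul`);
* **`diagSteps = {±(e₁ + e₂), ±(e₁ - e₂)}`** and the **`d_{xy}` form factor `dxyFormFactor`**
  (`+1` on `±(e₁ + e₂)`, `-1` on `±(e₁ - e₂)`, `0` elsewhere) with its `B₂g` law under the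
  generators of the square-lattice point group `D₄`: odd under the rotation `(a, b) ↦ (-b, a)`
  (`dxyFormFactor_rotate`) and the axis reflection `(a, b) ↦ (a, -b)` (`dxyFormFactor_reflect`),
  even under `(a, b) ↦ (b, a)` (`dxyFormFactor_swap`) and `e ↦ -e`; `diagSteps` is permuted by
  these maps (`sum_diagSteps_rotate/reflect`) and disjoint from `{0} ∪ unitSteps`;
* `localPairOn diagSteps dxyFormFactor L x = (1/√2) • (B_x(1,1) + B_x(-1,-1) - B_x(1,-1) - B_x(-1,1))`
  (`localPairOn_diagSteps_dxyFormFactor`, verbatim the `let B / P₂` block of the requesting route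
  statements) and `localPair dWaveFormFactor L x = localPairOn unitSteps dWaveFormFactor L x`;
* `D₄` characters `a2gChar` (`+1` on rotations, `-1` on reflections) and
  `b2gChar = a2gChar * b1gChar` (`xy`), proved multiplicative, in the conventions of `d4Site`
  (`r i ↦ rot^i`, `sr i ↦ refl ∘ rot^i`).

## Sources

D. J. Scalapino, Phys. Rep. 250 (1995) 329, §2, eq. (2.2)–(2.3) (singlet pair field
`Δ_g = Σ_x Σ_e (g e/√2)(c_{x↑}c_{x+e,↓} - c_{x↓}c_{x+e,↑})` with a bond form factor `g`);
S. Raghu, S. A. Kivelson, D. J. Scalapino, Phys. Rev. B 81 (2010) 224505, §III (singlet channels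
of the tetragonal point group: `A₁g ∼ 1, x² + y²`, `A₂g ∼ xy(x² - y²)`, `B₁g ∼ x² - y²`,
`B₂g ∼ xy`, with `x ↦ sin kₓ`, `x² ↦ cos kₓ`; `d_{xy}` leads for `n < 0.6` at `t' = 0`);
H. F. Jones, *Groups, Representations and Physics* (1990), p. 68, Problem 4.5 (character table of
`D₄`). The form factor `+1` on `±(e₁ + e₂)`, `-1` on `±(e₁ - e₂)` has lattice Fourier transform
`2 cos(kₓ + k_y) - 2 cos(kₓ - k_y) = -4 sin kₓ sin k_y ∼ xy`.

## Design notes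

* The body of `localPairOn` is literally that of `localPair` with the step set abstracted, so the
  bridge lemmas are `rfl` and route statements inlining the sum can be re-set to the named form
  without change of meaning; `singletBond L x e` is literally the summand (the `let B := fun x e
  => …` block of those statements; `localPairOn_eq_sum_singletBond` is `rfl`) and is definitionally
  `bondPair (ofTorusSite x) (ofTorusSite (x + Torus.proj L e))` for the two-site `bondPair` of
  `Literature.Barriers.HubbardSuperconductivity.HohenbergMerminWagnerPairing` (not imported: a
  barrier file sits above this library in the import cone).
* As for `localPair`, for sides `L ≤ 2` distinct steps of `ℤ²` may project to the same torus
  step; they are summed term by term, exactly as written.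
* Deliberately NOT here: the operator-level `D₄`-covariance
  `U_γ (localPairOn S g L x) U_γ⁻¹ = localPairOn S (g ∘ γ̂⁻¹) L (γ x)` for `γ̂`-invariant `S`,
  which needs a Fock-space implementation `U_γ` of orbital permutations (requested separately);
  this file provides the step-set and form-factor input such a lemma consumes
  (`sum_diagSteps_rotate/reflect`, `dxyFormFactor_rotate/reflect`, `b2gChar`). Also not here: the
  pair-chirality density `i (P₁ᴴ P₂ - P₂ᴴ P₁)` (a route-posited object).
-/

noncomputable section

namespace Literature.MathematicalPhysics.QuantumLattice

open Matrix Finset Filter Literature.Probability.LatticeModels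
open scoped ComplexOrder

/-! ### Diagonal steps and the `d_{xy}` form factor -/

/-- The four diagonal (next-nearest-neighbour) steps `±(e₁ + e₂)`, `±(e₁ - e₂)` of `ℤ²`.
Raghu–Kivelson–Scalapino, PRB 81 (2010) 224505, §III (`B₂g ∼ xy`, i.e. `sin kₓ sin k_y`,
a next-nearest-neighbour bond harmonic). [folklore] -/
def diagSteps : Finset (Site 2) :=
  {![1, 1], ![-1, -1], ![1, -1], ![-1, 1]}

/-- `diagSteps` has four elements. [folklore] -/
theorem card_diagSteps : diagSteps.card = 4 := by decide

/-- The origin is not a diagonal step. [folklore] -/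
theorem zero_not_mem_diagSteps : (0 : Site 2) ∉ diagSteps := by decide

/-- The step set `{0} ∪ unitSteps` of `localPair` is disjoint from `diagSteps`. [folklore] -/
theorem disjoint_insert_zero_unitSteps_diagSteps :
    Disjoint (insert (0 : Site 2) unitSteps) diagSteps := by decide

/-- `diagSteps` is symmetric under `e ↦ -e`. [folklore] -/
theorem neg_mem_diagSteps {e : Site 2} (h : e ∈ diagSteps) : -e ∈ diagSteps := by
  simp only [diagSteps, Finset.mem_insert, Finset.mem_singleton] at h ⊢
  rcases h with rfl | rfl | rfl | rfl <;> decide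

/-- The rotation `(a, b) ↦ (-b, a)` of `ℤ²` by `π/2` permutes `diagSteps`, so sums over it may be
reindexed. Scalapino, Phys. Rep. 250 (1995) 329, §2 (square-lattice point group). [folklore] -/
theorem sum_diagSteps_rotate {M : Type*} [AddCommMonoid M] (F : Site 2 → M) :
    ∑ e ∈ diagSteps, F ![-e 1, e 0] = ∑ e ∈ diagSteps, F e := by
  refine Finset.sum_nbij' (fun e : Site 2 => (![-e 1, e 0] : Site 2))
    (fun e : Site 2 => (![e 1, -e 0] : Site 2)) ?_ ?_ (fun e _ => by funext i; fin_cases i <;> simp)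
    (fun e _ => by funext i; fin_cases i <;> simp) fun _ _ => rfl
  all_goals
    intro e he
    simp only [diagSteps, Finset.mem_insert, Finset.mem_singleton] at he ⊢
    rcases he with rfl | rfl | rfl | rfl <;> decide

/-- The axis reflection `(a, b) ↦ (a, -b)` of `ℤ²` permutes `diagSteps` (it is an involution
preserving it). Scalapino, Phys. Rep. 250 (1995) 329, §2. [folklore] -/
theorem sum_diagSteps_reflect {M : Type*} [AddCommMonoid M] (F : Site 2 → M) :
    ∑ e ∈ diagSteps, F ![e 0, -e 1] = ∑ e ∈ diagSteps, F e := by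
  refine Finset.sum_nbij' (fun e : Site 2 => (![e 0, -e 1] : Site 2))
    (fun e : Site 2 => (![e 0, -e 1] : Site 2)) ?_ ?_ (fun e _ => by funext i; fin_cases i <;> simp)
    (fun e _ => by funext i; fin_cases i <;> simp) fun _ _ => rfl
  all_goals
    intro e he
    simp only [diagSteps, Finset.mem_insert, Finset.mem_singleton] at he ⊢
    rcases he with rfl | rfl | rfl | rfl <;> decide

/-- The `d_{xy}` (`B₂g`) bond form factor on `ℤ²`: `+1` on `±(e₁ + e₂)`, `-1` on `±(e₁ - e₂)`,
`0` on every other step (lattice Fourier transform `-4 sin kₓ sin k_y ∼ xy`).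
Raghu–Kivelson–Scalapino, PRB 81 (2010) 224505, §III (`B₂g: ψ ∼ xy`).
[cite: RaghuKivelsonScalapino2010, §III] -/
def dxyFormFactor (e : Site 2) : ℝ :=
  if e = ![1, 1] ∨ e = ![-1, -1] then 1
  else if e = ![1, -1] ∨ e = ![-1, 1] then -1 else 0

/-- `g_{xy}(1, 1) = 1`. Raghu–Kivelson–Scalapino (2010), §III. [folklore] -/
@[simp] theorem dxyFormFactor_one_one : dxyFormFactor ![1, 1] = 1 := by
  simp [dxyFormFactor]

/-- `g_{xy}(-1, -1) = 1`. Raghu–Kivelson–Scalapino (2010), §III. [folklore] -/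
@[simp] theorem dxyFormFactor_neg_one_neg_one : dxyFormFactor ![-1, -1] = 1 := by
  simp [dxyFormFactor]

/-- `g_{xy}(1, -1) = -1`. Raghu–Kivelson–Scalapino (2010), §III. [folklore] -/
@[simp] theorem dxyFormFactor_one_neg_one : dxyFormFactor ![1, -1] = -1 := by
  norm_num [dxyFormFactor, funext_iff, Fin.forall_fin_two]

/-- `g_{xy}(-1, 1) = -1`. Raghu–Kivelson–Scalapino (2010), §III. [folklore] -/
@[simp] theorem dxyFormFactor_neg_one_one : dxyFormFactor ![-1, 1] = -1 := by
  norm_num [dxyFormFactor, funext_iff, Fin.forall_fin_two]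

/-- The `d_{xy}` form factor vanishes at the origin. Raghu–Kivelson–Scalapino (2010), §III. [folklore] -/
@[simp] theorem dxyFormFactor_zero : dxyFormFactor 0 = 0 := by
  norm_num [dxyFormFactor, funext_iff, Fin.forall_fin_two]

/-- The `d_{xy}` form factor is supported on `diagSteps`. Raghu–Kivelson–Scalapino (2010), §III. [folklore] -/
theorem dxyFormFactor_eq_zero_of_not_mem {e : Site 2} (h : e ∉ diagSteps) : dxyFormFactor e = 0 := by
  simp only [diagSteps, Finset.mem_insert, Finset.mem_singleton, not_or] at h
  simp [dxyFormFactor, h.1, h.2.1, h.2.2.1, h.2.2.2]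

/-- The `d_{xy}` form factor vanishes on the nearest-neighbour steps `±e₁, ±e₂`.
Raghu–Kivelson–Scalapino (2010), §III. [folklore] -/
theorem dxyFormFactor_eq_zero_of_mem_unitSteps {e : Site 2} (h : e ∈ unitSteps) :
    dxyFormFactor e = 0 :=
  dxyFormFactor_eq_zero_of_not_mem
    (Finset.disjoint_left.mp disjoint_insert_zero_unitSteps_diagSteps (Finset.mem_insert_of_mem h))

/-- The `d_{xy}` form factor is even, `g_{xy}(-e) = g_{xy}(e)` (spin-singlet, even-parity
channel). Raghu–Kivelson–Scalapino (2010), §III. [folklore] -/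
theorem dxyFormFactor_neg (e : Site 2) : dxyFormFactor (-e) = dxyFormFactor e := by
  simp only [dxyFormFactor, funext_iff, Fin.forall_fin_two, cons_val_zero, cons_val_one, Pi.neg_apply]
  split_ifs <;> norm_num <;> omega

/-- `B₂g` symmetry, rotation: the `d_{xy}` form factor changes sign under the rotation
`(a, b) ↦ (-b, a)` by `π/2` (`χ_{B₂g}(C₄) = -1`). Raghu–Kivelson–Scalapino (2010), §III;
Jones (1990), p. 68. [cite: RaghuKivelsonScalapino2010, §III] -/
theorem dxyFormFactor_rotate (e : Site 2) : dxyFormFactor ![-e 1, e 0] = -dxyFormFactor e := by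
  simp only [dxyFormFactor, funext_iff, Fin.forall_fin_two, cons_val_zero, cons_val_one]
  split_ifs <;> norm_num <;> omega

/-- `B₂g` symmetry, axis reflection: the `d_{xy}` form factor changes sign under
`(a, b) ↦ (a, -b)` (`χ_{B₂g}(σᵥ) = -1`; contrast `dWaveFormFactor_reflect`, `B₁g` is even).
Raghu–Kivelson–Scalapino (2010), §III; Jones (1990), p. 68. [cite: RaghuKivelsonScalapino2010, §III] -/
theorem dxyFormFactor_reflect (e : Site 2) : dxyFormFactor ![e 0, -e 1] = -dxyFormFactor e := by
  simp only [dxyFormFactor, funext_iff, Fin.forall_fin_two, cons_val_zero, cons_val_one]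
  split_ifs <;> norm_num <;> omega

/-- `B₂g` symmetry, diagonal reflection: the `d_{xy}` form factor is invariant under
`(a, b) ↦ (b, a)` (`χ_{B₂g}(σ_d) = +1`). Raghu–Kivelson–Scalapino (2010), §III. [folklore] -/
theorem dxyFormFactor_swap (e : Site 2) : dxyFormFactor ![e 1, e 0] = dxyFormFactor e := by
  simp only [dxyFormFactor, funext_iff, Fin.forall_fin_two, cons_val_zero, cons_val_one]
  split_ifs <;> norm_num <;> omega

/-! ### `D₄` characters `A₂g` and `B₂g` -/

/-- The `A₂g` character of `D₄ = DihedralGroup 4` (conventions of `d4Site`: `r i ↦ rot^i`,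
`sr i ↦ refl ∘ rot^i`): `+1` on the four rotations, `-1` on the four reflections (basis function
`xy(x² - y²)`). Jones (1990), p. 68, Problem 4.5 (character table of `D₄`). [cite: Jones1990, p. 68, Problem 4.5] -/
def a2gChar : DihedralGroup 4 → ℂ
  | DihedralGroup.r _ => 1
  | DihedralGroup.sr _ => -1

/-- `χ_{A₂g}(1) = 1`. Jones (1990), p. 68. [folklore] -/
@[simp] theorem a2gChar_one : a2gChar 1 = 1 := by rw [DihedralGroup.one_def]; simp [a2gChar]

/-- `χ_{A₂g}` is multiplicative (rotations form the index-two subgroup). Jones (1990), p. 68. [folklore] -/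
theorem a2gChar_mul (γ₁ γ₂ : DihedralGroup 4) : a2gChar (γ₁ * γ₂) = a2gChar γ₁ * a2gChar γ₂ := by
  rcases γ₁ with i | i <;> rcases γ₂ with j | j <;>
    simp [a2gChar, DihedralGroup.r_mul_r, DihedralGroup.r_mul_sr, DihedralGroup.sr_mul_r,
      DihedralGroup.sr_mul_sr]

/-- The `B₂g` (`xy`) character of `D₄`: `(-1)^i` on the rotation `r i`, `-(-1)^i` on the
reflection `sr i = refl ∘ rot^i`; i.e. `-1` on the rotations by `±π/2` and on the axis reflections
`s`, `s r²`, `+1` on `1`, `r²` and the diagonal reflections `s r^{±1}`.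
Jones (1990), p. 68, Problem 4.5; Raghu–Kivelson–Scalapino (2010), §III (`B₂g ∼ xy`).
[cite: Jones1990, p. 68, Problem 4.5] -/
def b2gChar : DihedralGroup 4 → ℂ
  | DihedralGroup.r i => (-1) ^ i.val
  | DihedralGroup.sr i => -(-1) ^ i.val

/-- `χ_{B₂g} = χ_{A₂g} · χ_{B₁g}` (`xy · 1` on rotations; `B₁ ⊗ A₂ = B₂`). Jones (1990), p. 68. [folklore] -/
theorem b2gChar_eq_a2gChar_mul_b1gChar (γ : DihedralGroup 4) :
    b2gChar γ = a2gChar γ * b1gChar γ := by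
  rcases γ with i | i <;> simp [b2gChar, a2gChar, b1gChar]

/-- `χ_{B₂g}(1) = 1`. Jones (1990), p. 68. [folklore] -/
@[simp] theorem b2gChar_one : b2gChar 1 = 1 := by
  rw [b2gChar_eq_a2gChar_mul_b1gChar, a2gChar_one, b1gChar_one, mul_one]

/-- `χ_{B₂g}` is a (one-dimensional) character of `D₄`: multiplicative (from `a2gChar_mul` and the
discharged named fact `b1gChar_mul`). Jones (1990), p. 68, Problem 4.5. [folklore] -/
theorem b2gChar_mul (γ₁ γ₂ : DihedralGroup 4) : b2gChar (γ₁ * γ₂) = b2gChar γ₁ * b2gChar γ₂ := by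
  simp only [b2gChar_eq_a2gChar_mul_b1gChar, a2gChar_mul, b1gChar_mul_holds γ₁ γ₂]
  ring

/-! ### Singlet bonds, local pairs and pair fields on an arbitrary step set -/

/-- The singlet pair annihilation operator on the bond `(x, x + e)` of the fermionic torus
`(ℤ/Lℤ)²`: `B_x(e) = c_{x↑} c_{x+e,↓} - c_{x↓} c_{x+e,↑}`, the neighbour `x + e` computed in
`(ℤ/Lℤ)²` (`Torus.proj`) and orbitals taken via `FermionTorus.ofTorusSite`; the summand of
`localPair`/`localPairOn` without its weight `g e/√2`.
Scalapino, Phys. Rep. 250 (1995) 329, §2, eq. (2.2)–(2.3). [folklore] -/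
def singletBond (L : ℕ) [NeZero L] (x : TorusSite 2 L) (e : Site 2) :
    Matrix (Finset (Orb (FermionTorus 2 L))) (Finset (Orb (FermionTorus 2 L))) ℂ :=
  annihilation (orb (FermionTorus.ofTorusSite x) 0) *
      annihilation (orb (FermionTorus.ofTorusSite (x + Torus.proj L e)) 1) -
    annihilation (orb (FermionTorus.ofTorusSite x) 1) *
      annihilation (orb (FermionTorus.ofTorusSite (x + Torus.proj L e)) 0)

/-- The local singlet pair annihilation operator at the torus site `x` with form factor `g` on
the finite step set `S ⊆ ℤ²`:
`P_x = Σ_{e ∈ S} (g e / √2) (c_{x↑} c_{x+e,↓} - c_{x↓} c_{x+e,↑})`; `localPair g L x` is the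
case `S = {0} ∪ unitSteps` (`localPairOn_insert_zero_unitSteps`, `rfl`).
Scalapino, Phys. Rep. 250 (1995) 329, §2, eq. (2.2)–(2.3). [folklore] -/
def localPairOn (S : Finset (Site 2)) (g : Site 2 → ℝ) (L : ℕ) [NeZero L] (x : TorusSite 2 L) :
    Matrix (Finset (Orb (FermionTorus 2 L))) (Finset (Orb (FermionTorus 2 L))) ℂ :=
  ∑ e ∈ S, ((g e / Real.sqrt 2 : ℝ) : ℂ) •
    (annihilation (orb (FermionTorus.ofTorusSite x) 0) *
        annihilation (orb (FermionTorus.ofTorusSite (x + Torus.proj L e)) 1) -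
      annihilation (orb (FermionTorus.ofTorusSite x) 1) *
        annihilation (orb (FermionTorus.ofTorusSite (x + Torus.proj L e)) 0))

/-- The pair field `Δ_{g,S} = Σ_x P_x` on the torus of side `L`, for the form factor `g` on the
step set `S`; `pairField g L` is the case `S = {0} ∪ unitSteps`.
Scalapino, Phys. Rep. 250 (1995) 329, §2, eq. (2.2). [folklore] -/
def pairFieldOn (S : Finset (Site 2)) (g : Site 2 → ℝ) (L : ℕ) [NeZero L] :
    Matrix (Finset (Orb (FermionTorus 2 L))) (Finset (Orb (FermionTorus 2 L))) ℂ :=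
  ∑ x : TorusSite 2 L, localPairOn S g L x

section Torus

variable (g : Site 2 → ℝ) (L : ℕ) [NeZero L]

/-- `(B_x(e))ᴴ = c†_{x+e,↓} c†_{x↑} - c†_{x+e,↑} c†_{x↓}`. Scalapino, Phys. Rep. 250 (1995) 329, §2. [folklore] -/
theorem singletBond_conjTranspose (x : TorusSite 2 L) (e : Site 2) :
    (singletBond L x e)ᴴ =
      creation (orb (FermionTorus.ofTorusSite (x + Torus.proj L e)) 1) *
          creation (orb (FermionTorus.ofTorusSite x) 0) -
        creation (orb (FermionTorus.ofTorusSite (x + Torus.proj L e)) 0) *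
          creation (orb (FermionTorus.ofTorusSite x) 1) := by
  simp [singletBond, conjTranspose_sub, conjTranspose_mul, annihilation_conjTranspose]

/-- Bond reversal: `B_x(-e) = B_{x-e}(e)` — the singlet bond operator is symmetric in the two
ends of the bond (`c_{y+e,↑} c_{y↓} - c_{y+e,↓} c_{y↑} = c_{y↑} c_{y+e,↓} - c_{y↓} c_{y+e,↑}` by
the CAR `c_a c_b = -c_b c_a`, `annihilation_anticommute_holds`).
Scalapino, Phys. Rep. 250 (1995) 329, §2. [folklore] -/
theorem singletBond_neg (x : TorusSite 2 L) (e : Site 2) :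
    singletBond L x (-e) = singletBond L (x - Torus.proj L e) e := by
  have hproj : Torus.proj L (-e) = -Torus.proj L e := by funext i; simp
  have hac := annihilation_anticommute_holds (ι := Orb (FermionTorus 2 L))
  have h1 := eq_neg_of_add_eq_zero_left (hac (orb (FermionTorus.ofTorusSite x) 0)
    (orb (FermionTorus.ofTorusSite (x - Torus.proj L e)) 1))
  have h2 := eq_neg_of_add_eq_zero_left (hac (orb (FermionTorus.ofTorusSite x) 1)
    (orb (FermionTorus.ofTorusSite (x - Torus.proj L e)) 0))
  simp only [singletBond, hproj, ← sub_eq_add_neg, sub_add_cancel]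
  rw [h1, h2]; abel

/-- `localPairOn` unfolded as a weighted sum of singlet bonds,
`P_x = Σ_{e ∈ S} (g e/√2) • B_x(e)` (`rfl`). Scalapino, Phys. Rep. 250 (1995) 329, §2. [folklore] -/
theorem localPairOn_eq_sum_singletBond (S : Finset (Site 2)) (x : TorusSite 2 L) :
    localPairOn S g L x = ∑ e ∈ S, ((g e / Real.sqrt 2 : ℝ) : ℂ) • singletBond L x e := rfl

/-- **Bridge to `localPair`**: on the step set `{0} ∪ unitSteps`, `localPairOn` is `localPair`
(definitionally). Scalapino, Phys. Rep. 250 (1995) 329, §2, eq. (2.2)–(2.3). [folklore] -/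
theorem localPairOn_insert_zero_unitSteps (x : TorusSite 2 L) :
    localPairOn (insert 0 unitSteps) g L x = localPair g L x := rfl

/-- **Bridge to `pairField`**: `pairFieldOn (insert 0 unitSteps) g L = pairField g L`
(definitionally). Scalapino, Phys. Rep. 250 (1995) 329, §2, eq. (2.2). [folklore] -/
theorem pairFieldOn_insert_zero_unitSteps :
    pairFieldOn (insert 0 unitSteps) g L = pairField g L := rfl

/-- No steps, no pair: `localPairOn ∅ g L x = 0`. [folklore] -/
@[simp] theorem localPairOn_empty (x : TorusSite 2 L) : localPairOn ∅ g L x = 0 := Finset.sum_empty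

/-- Adding a step adds its weighted bond. Scalapino, Phys. Rep. 250 (1995) 329, §2. [folklore] -/
theorem localPairOn_insert {e : Site 2} {S : Finset (Site 2)} (h : e ∉ S) (x : TorusSite 2 L) :
    localPairOn (insert e S) g L x =
      ((g e / Real.sqrt 2 : ℝ) : ℂ) • singletBond L x e + localPairOn S g L x :=
  Finset.sum_insert h

/-- Additivity in the step set. Scalapino, Phys. Rep. 250 (1995) 329, §2. [folklore] -/
theorem localPairOn_union {S T : Finset (Site 2)} (h : Disjoint S T) (x : TorusSite 2 L) :
    localPairOn (S ∪ T) g L x = localPairOn S g L x + localPairOn T g L x :=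
  Finset.sum_union h

/-- `localPairOn S g` depends on `g` only through its values on `S`. [folklore] -/
theorem localPairOn_congr {S : Finset (Site 2)} {g g' : Site 2 → ℝ} (h : ∀ e ∈ S, g e = g' e)
    (x : TorusSite 2 L) : localPairOn S g L x = localPairOn S g' L x :=
  Finset.sum_congr rfl fun e he => by rw [h e he]

/-- Steps outside the support of `g` may be dropped: if `S ⊆ T` and `g` vanishes on `T \ S` then
`localPairOn S g = localPairOn T g`. [folklore] -/
theorem localPairOn_subset {S T : Finset (Site 2)} (hST : S ⊆ T)
    (hg : ∀ e ∈ T, e ∉ S → g e = 0) (x : TorusSite 2 L) :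
    localPairOn S g L x = localPairOn T g L x :=
  Finset.sum_subset hST fun e heT heS => by simp [hg e heT heS]

/-- Linearity in the form factor: additivity. Scalapino, Phys. Rep. 250 (1995) 329, §2. [folklore] -/
theorem localPairOn_add (S : Finset (Site 2)) (g g' : Site 2 → ℝ) (x : TorusSite 2 L) :
    localPairOn S (g + g') L x = localPairOn S g L x + localPairOn S g' L x := by
  simp only [localPairOn_eq_sum_singletBond, Pi.add_apply, add_div, Complex.ofReal_add, add_smul,
    Finset.sum_add_distrib]

/-- Linearity in the form factor: homogeneity. Scalapino, Phys. Rep. 250 (1995) 329, §2. [folklore] -/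
theorem localPairOn_smul (S : Finset (Site 2)) (c : ℝ) (x : TorusSite 2 L) :
    localPairOn S (c • g) L x = (c : ℂ) • localPairOn S g L x := by
  simp only [localPairOn_eq_sum_singletBond, Pi.smul_apply, smul_eq_mul, mul_div_assoc,
    Complex.ofReal_mul, mul_smul, Finset.smul_sum]

/-- `localPairOn S (-g) = -localPairOn S g`. [folklore] -/
theorem localPairOn_neg (S : Finset (Site 2)) (x : TorusSite 2 L) :
    localPairOn S (-g) L x = -localPairOn S g L x := by
  simp only [localPairOn_eq_sum_singletBond, Pi.neg_apply, neg_div, Complex.ofReal_neg, neg_smul,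
    Finset.sum_neg_distrib]

/-- The `d_{x²-y²}` local pair needs only the four unit steps (its form factor vanishes at the
origin, `dWaveFormFactor_zero`): `localPair g_d L x = localPairOn unitSteps g_d L x`.
Scalapino, Phys. Rep. 250 (1995) 329, §2, eq. (2.3). [folklore] -/
theorem localPair_dWave_eq_localPairOn_unitSteps (x : TorusSite 2 L) :
    localPair dWaveFormFactor L x = localPairOn unitSteps dWaveFormFactor L x := by
  rw [← localPairOn_insert_zero_unitSteps]
  refine (localPairOn_subset dWaveFormFactor L (Finset.subset_insert 0 unitSteps)
    (fun e he hne => ?_) x).symm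
  obtain rfl : e = 0 := by simpa [hne] using he
  exact dWaveFormFactor_zero

/-- **The `d_{xy}` local pair, expanded**: `localPairOn diagSteps g_{xy} L x =
(1/√2) • (B_x(1,1) + B_x(-1,-1) - B_x(1,-1) - B_x(-1,1))` — verbatim the four-bond `B₂g` singlet
sum `P₂` inlined in the route statements that requested this notion.
Raghu–Kivelson–Scalapino (2010), §III (`B₂g ∼ xy`); Scalapino, Phys. Rep. 250 (1995) 329, §2. [folklore] -/
theorem localPairOn_diagSteps_dxyFormFactor (x : TorusSite 2 L) :
    localPairOn diagSteps dxyFormFactor L x =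
      ((1 / Real.sqrt 2 : ℝ) : ℂ) •
        (singletBond L x ![1, 1] + singletBond L x ![-1, -1] - singletBond L x ![1, -1] -
          singletBond L x ![-1, 1]) := by
  rw [localPairOn_eq_sum_singletBond, diagSteps, Finset.sum_insert (by decide),
    Finset.sum_insert (by decide), Finset.sum_insert (by decide), Finset.sum_singleton,
    dxyFormFactor_one_one, dxyFormFactor_neg_one_neg_one, dxyFormFactor_one_neg_one,
    dxyFormFactor_neg_one_one]
  simp only [neg_div, Complex.ofReal_neg, neg_smul, smul_add, smul_sub]
  abel

/-- `Δ_{g,S}ᴴ Δ_{g,S}` is positive semidefinite. (Elementary.) [folklore] -/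
theorem pairFieldOn_conjTranspose_mul_self_posSemidef (S : Finset (Site 2)) :
    ((pairFieldOn S g L)ᴴ * pairFieldOn S g L).PosSemidef :=
  posSemidef_conjTranspose_mul_self _

/-- Additivity of the pair field in the step set. Scalapino, Phys. Rep. 250 (1995) 329, §2. [folklore] -/
theorem pairFieldOn_union {S T : Finset (Site 2)} (h : Disjoint S T) :
    pairFieldOn (S ∪ T) g L = pairFieldOn S g L + pairFieldOn T g L := by
  simp only [pairFieldOn, localPairOn_union g L h, Finset.sum_add_distrib]

/-- Linearity of the pair field in the form factor. Scalapino, Phys. Rep. 250 (1995) 329, §2. [folklore] -/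
theorem pairFieldOn_add (S : Finset (Site 2)) (g g' : Site 2 → ℝ) :
    pairFieldOn S (g + g') L = pairFieldOn S g L + pairFieldOn S g' L := by
  simp only [pairFieldOn, localPairOn_add, Finset.sum_add_distrib]

/-- Homogeneity of the pair field in the form factor. Scalapino, Phys. Rep. 250 (1995) 329, §2. [folklore] -/
theorem pairFieldOn_smul (S : Finset (Site 2)) (c : ℝ) :
    pairFieldOn S (c • g) L = (c : ℂ) • pairFieldOn S g L := by
  simp only [pairFieldOn, localPairOn_smul, Finset.smul_sum]

end Torus

end Literature.MathematicalPhysics.QuantumLattice
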